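import Summits.ABC.ABC.Theorems.IsogenyGlueCongruenceEllipticGluingPrimeBoundStubBigImageTorsionCore
import Summits.ABC.ABC.Theorems.IsogenyGlueCongruenceEllipticGluingPrimeBoundStubMinkowski
import Literature.NumberTheory.GaloisRepresentations.AbsGaloisGroup
import HarnessLib

/-!
# Crux `EllipticGluingPrimeBound`, line SketchIdeator5 — primes dividing the degree of the
# endomorphism field of an abelian variety over `ℚ`

Helper theorem of line `SketchIdeator5` (slices of the free branch `U_simple`) of crux U
`Summit.ABC.ABC.Theses.IsogenyGlueCongruence.EllipticGluingPrimeBound` (item stmt-ABC-13919),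
namespace `Summit.ABC.ABC.Theorems.GluingSlices`; lands `--supports stmt-ABC-13919`.

**Statement (`prime_le_of_dvd_card_endGaloisImage`).** Let `A/ℚ` be an abelian variety and let
`Q_A` be the (finite) set of ring automorphisms of `End(A_ℚ̄)` induced by `Gal(ℚ̄/ℚ)` — a group,
`Q_A = Gal(L_A/ℚ)` for `L_A` the field of definition of the geometric endomorphisms.  Every prime
`ℓ` dividing `#Q_A` satisfies `ℓ ≤ 4 (dim A)² + 1`.

**Proof.** `Gal(ℚ̄/ℚ)` acts `ℤ`-linearly on the lattice `End(A_ℚ̄)`, free of rank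
`m ≤ 4 dim A · dim A` (`BigImage.homGaloisLattice A A`), by `σ ↦ galConj σ`; the image group of
this representation has the same cardinality as `Q_A` (a ring automorphism and its underlying
additive map determine each other) and is isomorphic to a finite subgroup of `GL_m(ℤ)`
(`BigImage.exists_subgroup_generalLinearGroup_mulEquiv`), so Minkowski (`stub_minkowski`,
landed) gives `ℓ ≤ m + 1`.  This is the dimension-only input of the endomorphism-field slices of
the line (the partner's height, conductor and the degree of `L_A` never enter).  No named facts;
no definitions.
-/

noncomputable section

-- `Summit.<Summit>.<Problem>` is the mandated summit-side namespace (CONVENTIONS §2); for the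
-- single-conjunct summit `ABC` the two coincide, so the duplicate `ABC.ABC` is deliberate.
set_option linter.dupNamespace false

namespace Summit.ABC.ABC.Theorems.GluingSlices

open CategoryTheory CategoryTheory.Limits AlgebraicGeometry
open Literature.AlgebraicGeometry.Motives
open Summit.ABC.ABC.Theorems.IsotypicMinkowski

/-- **Primes dividing the degree of the endomorphism field.** For an abelian variety `A/ℚ`, every
prime `ℓ` dividing the number of ring automorphisms of `End(A_ℚ̄)` induced by `Gal(ℚ̄/ℚ)` (the
order of `Gal(L_A/ℚ)`, `L_A` the field of definition of the geometric endomorphisms) satisfies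
`ℓ ≤ 4 (dim A)² + 1` (Minkowski on the Galois lattice `End(A_ℚ̄)` of rank `≤ 4 (dim A)²`). -/
theorem prime_le_of_dvd_card_endGaloisImage :
    ∀ (A : AbelianVariety.{0} ℚ) (ℓ : ℕ), ℓ.Prime →
      ℓ ∣ Nat.card (Set.range (MulSemiringAction.toRingHom
        (AlgebraicClosure ℚ ≃ₐ[ℚ] AlgebraicClosure ℚ) (End (A.baseChange (AlgebraicClosure ℚ))))) →
      ℓ ≤ 4 * A.dim ^ 2 + 1 := by
  intro A ℓ hℓ hdvd
  -- the lattice `End(A_ℚ̄)`: free of finite rank `≤ 4 dim A · dim A`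
  obtain ⟨hfree, hfinite, hrank, -⟩ := BigImage.homGaloisLattice A A
  haveI := hfree
  haveI := hfinite
  -- the representation of `Aut(ℚ̄/ℚ)` on `End(A_ℚ̄)` by `galConj`
  let θ (σ : AlgebraicClosure ℚ ≃ₐ[ℚ] AlgebraicClosure ℚ) :
      (A.baseChange (AlgebraicClosure ℚ) ⟶ A.baseChange (AlgebraicClosure ℚ)) →ₗ[ℤ]
        (A.baseChange (AlgebraicClosure ℚ) ⟶ A.baseChange (AlgebraicClosure ℚ)) :=
    (AddMonoidHom.mk' (fun r ↦ A.galConj (AlgebraicClosure ℚ) σ r)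
      (A.galConj_add (AlgebraicClosure ℚ) σ)).toIntLinearMap
  have θ_apply : ∀ σ r, θ σ r = A.galConj (AlgebraicClosure ℚ) σ r := fun _ _ ↦ rfl
  let ρ : Representation ℤ (AlgebraicClosure ℚ ≃ₐ[ℚ] AlgebraicClosure ℚ)
      (A.baseChange (AlgebraicClosure ℚ) ⟶ A.baseChange (AlgebraicClosure ℚ)) :=
    { toFun := θ
      map_one' := by
        refine LinearMap.ext fun r ↦ ?_
        rw [θ_apply]
        exact A.galConj_one (AlgebraicClosure ℚ) r
      map_mul' := fun σ τ ↦ by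
        refine LinearMap.ext fun r ↦ ?_
        rw [θ_apply]
        exact A.galConj_mul (AlgebraicClosure ℚ) _ _ r }
  have ρ_apply : ∀ σ r, ρ σ r = A.galConj (AlgebraicClosure ℚ) σ r := fun _ _ ↦ rfl
  -- the ring automorphism `σ • ·` and the additive map `ρ σ` determine each other
  let Ψ : (End (A.baseChange (AlgebraicClosure ℚ)) →+* End (A.baseChange (AlgebraicClosure ℚ))) →
      ((A.baseChange (AlgebraicClosure ℚ) ⟶ A.baseChange (AlgebraicClosure ℚ)) →ₗ[ℤ]
        (A.baseChange (AlgebraicClosure ℚ) ⟶ A.baseChange (AlgebraicClosure ℚ))) := fun t ↦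
    (AddMonoidHom.mk' (fun f ↦ End.asHom (t (End.of f))) (fun f g ↦ by
      change t (End.of f + End.of g) = t (End.of f) + t (End.of g)
      rw [t.map_add])).toIntLinearMap
  have hΨinj : Function.Injective Ψ := by
    intro t t' h
    refine RingHom.ext fun f ↦ ?_
    exact LinearMap.congr_fun h (End.asHom f)
  have hrange : Set.range ρ = Ψ '' Set.range (MulSemiringAction.toRingHom
      (AlgebraicClosure ℚ ≃ₐ[ℚ] AlgebraicClosure ℚ) (End (A.baseChange (AlgebraicClosure ℚ)))) := by
    ext x
    constructor
    · rintro ⟨σ, rfl⟩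
      exact ⟨MulSemiringAction.toRingHom _ _ σ, ⟨σ, rfl⟩, LinearMap.ext fun f ↦ rfl⟩
    · rintro ⟨_, ⟨σ, rfl⟩, rfl⟩
      exact ⟨σ, LinearMap.ext fun f ↦ rfl⟩
  -- so the image group of `ρ` has the cardinality of `Q_A`
  have hcardS : Nat.card (Set.range ρ) = Nat.card (Set.range (MulSemiringAction.toRingHom
      (AlgebraicClosure ℚ ≃ₐ[ℚ] AlgebraicClosure ℚ) (End (A.baseChange (AlgebraicClosure ℚ))))) := by
    rw [hrange]
    exact Nat.card_image_of_injective hΨinj _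
  have hcardR : Nat.card ρ.asGroupHom.range = Nat.card (Set.range ρ) := by
    refine Nat.card_congr ?_
    refine Equiv.ofBijective (fun u ↦ ⟨(u.1 : _), by
      obtain ⟨σ, hσ⟩ := u.2
      exact ⟨σ, by rw [← hσ, Representation.asGroupHom_apply]⟩⟩) ⟨?_, ?_⟩
    · intro u v h
      apply Subtype.ext
      apply Units.ext
      exact congrArg Subtype.val h
    · rintro ⟨x, σ, rfl⟩
      exact ⟨⟨ρ.asGroupHom σ, σ, rfl⟩, Subtype.ext (Representation.asGroupHom_apply ρ σ)⟩
  -- finite image, inside `GL_m(ℤ)`; Minkowski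
  have hfinS : (Set.range ρ).Finite := by
    rw [hrange]
    exact (A.finite_range_toRingHom_galois (AbelianVariety.module_finite_hom_holds _ _)
      AbelianVariety.isTorsionFree_int_hom_of_charZero).image Ψ
  haveI : Finite ρ.asGroupHom.range := BigImage.finite_range_asGroupHom ρ hfinS
  obtain ⟨G, ⟨e⟩⟩ := BigImage.exists_subgroup_generalLinearGroup_mulEquiv ρ
  haveI : Finite G := Finite.of_equiv _ e.toEquiv
  have hdvdG : ℓ ∣ Nat.card G := by
    rwa [← Nat.card_congr e.toEquiv, hcardR, hcardS]
  have hmink := stub_minkowski _ ℓ hℓ G hdvdG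
  have hsq : A.dim ^ 2 = A.dim * A.dim := sq A.dim
  rw [hsq]
  calc ℓ ≤ Module.finrank ℤ (A.baseChange (AlgebraicClosure ℚ) ⟶ A.baseChange (AlgebraicClosure ℚ))
        + 1 := hmink
    _ ≤ 4 * A.dim * A.dim + 1 := by omega
    _ = 4 * (A.dim * A.dim) + 1 := by ring

end Summit.ABC.ABC.Theorems.GluingSlices

end
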